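import Summits.BirchSwinnertonDyer.Rank1Residual.X11a.LambdaNorm
import Mathlib.Analysis.Normed.Group.Ultra
import HarnessLib

/-!
# `normLam` is insensitive to unit multiples over a valuation ring (class X11a, (V-inv) API, part 2)
# (cell `b2b-bsdres`, unit `b2b-bsdres-x11a`, gen 15)

HONEST FRAMING (run/shared/lean/b2b/bsd-rank1-residual/, verbatim in every file): the goal of the
cell is to DELETE the COMBINATION-SHAPED residual classes of the Birch–Swinnerton-Dyer formula for
ALL analytic-rank `≤ 1` elliptic curves over `ℚ` — "full BSD formula for every rank `≤ 1` curve in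
class `C`" assembled STRICTLY from published theorems — so that the rank-`≤ 1` remainder becomes
exactly the CONSTRUCTION-SHAPED classes, which are TYPED (missing-input `Prop`s), NOT attempted.
This is not "finishing BSD". Research route; NO CLAIM BEYOND STATED CLASSES. Theorems only.

Over a non-archimedean normed ring `R` with multiplicative norm (`ℚ̄_p`, `ℂ_p`, a finite extension
of `ℚ_p`), multiplying a power series `F` that attains its maximal coefficient norm by a power series
`U` with `‖U₀‖ = 1` and all `‖Uᵢ‖ ≤ 1` — e.g. the image of a UNIT of `Λ_𝒪 = 𝒪⟦T⟧` — does not change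
`normLam` (`normLam_mul_of_integral_unit`), and `U·F` again attains its maximum
(`hasMaxCoeff_mul_of_integral_unit`). This is the `𝒪`-coefficient version of
`LambdaNorm.normLam_mul_of_norm_constantCoeff_eq_one` (there over `ℤ_p`), needed to read X. Wan's
"`char(Sel) = (L_f)` in `Λ_𝒪 ⊗ ℚ_p`" (`L = c · u · G`, `u ∈ Λ_𝒪^×`) as `λ(G) = λ(L)`
(Emerton–Pollack–Weston's `λ^alg = λ^an` at the weight-`k` member; Def. 4.4.6).

References: [Washington1997] §7.1; [EmertonPollackWeston2006] Def. 4.4.6; [Wan2015] Thm. 4.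
-/

noncomputable section

open scoped Classical

open Literature.NumberTheory.EllipticCurves

set_option autoImplicit false

namespace Summit.BirchSwinnertonDyer.Rank1Residual.X11a.LambdaNorm

section Ultrametric

variable {R : Type*} [NormedRing R] [IsUltrametricDist R] [NormMulClass R]

omit [NormMulClass R] in
/-- Ultrametric strict bound for a finite sum: all terms `< m` (`m > 0`) ⇒ the sum is `< m`. [folklore] -/
theorem norm_sum_lt_of_forall_lt {ι : Type*} {s : Finset ι} {f : ι → R} {m : ℝ} (hm : 0 < m)
    (h : ∀ i ∈ s, ‖f i‖ < m) : ‖∑ i ∈ s, f i‖ < m := by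
  rcases s.eq_empty_or_nonempty with hs | hs
  · rw [hs, Finset.sum_empty, norm_zero]; exact hm
  · refine lt_of_le_of_lt (hs.norm_sum_le_sup'_norm f) ?_
    rw [Finset.sup'_lt_iff]
    exact h

/-- Coefficient formula with the ultrametric bound: if every `‖Uᵢ‖ ≤ 1` and every `‖Fⱼ‖ ≤ m` for
`j ≤ n`, then `‖(U·F)ₙ‖ ≤ m`. [folklore] -/
theorem norm_coeff_mul_le_of_integral {U F : PowerSeries R} (hU : ∀ i, ‖PowerSeries.coeff i U‖ ≤ 1)
    {n : ℕ} {m : ℝ} (hm : 0 ≤ m) (hF : ∀ j ≤ n, ‖PowerSeries.coeff j F‖ ≤ m) :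
    ‖PowerSeries.coeff n (U * F)‖ ≤ m := by
  rw [PowerSeries.coeff_mul]
  refine IsUltrametricDist.norm_sum_le_of_forall_le_of_nonneg hm fun ij hij => ?_
  rw [norm_mul]
  have hj : ij.2 ≤ n := by
    have := Finset.HasAntidiagonal.mem_antidiagonal.mp hij; omega
  calc ‖PowerSeries.coeff ij.1 U‖ * ‖PowerSeries.coeff ij.2 F‖
      ≤ 1 * m := mul_le_mul (hU _) (hF _ hj) (norm_nonneg _) zero_le_one
    _ = m := one_mul m

/-- Strict version below the `λ`-index: if every `‖Uᵢ‖ ≤ 1` and every `‖Fⱼ‖ < m` for `j ≤ n`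
(`m > 0`), then `‖(U·F)ₙ‖ < m`. [folklore] -/
theorem norm_coeff_mul_lt_of_integral {U F : PowerSeries R} (hU : ∀ i, ‖PowerSeries.coeff i U‖ ≤ 1)
    {n : ℕ} {m : ℝ} (hm : 0 < m) (hF : ∀ j ≤ n, ‖PowerSeries.coeff j F‖ < m) :
    ‖PowerSeries.coeff n (U * F)‖ < m := by
  rw [PowerSeries.coeff_mul]
  refine norm_sum_lt_of_forall_lt hm fun ij hij => ?_
  rw [norm_mul]
  have hj : ij.2 ≤ n := by
    have := Finset.HasAntidiagonal.mem_antidiagonal.mp hij; omega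
  calc ‖PowerSeries.coeff ij.1 U‖ * ‖PowerSeries.coeff ij.2 F‖
      ≤ 1 * ‖PowerSeries.coeff ij.2 F‖ :=
        mul_le_mul_of_nonneg_right (hU _) (norm_nonneg _)
    _ < m := by rw [one_mul]; exact hF _ hj

/-- At the `λ`-index the leading term survives: `‖(U·F)_λ‖ = ‖F_λ‖` when `‖U₀‖ = 1`, all `‖Uᵢ‖ ≤ 1`,
and `λ = normLam F` (earlier coefficients of `F` are strictly smaller). [folklore] -/
theorem norm_coeff_mul_normLam_eq {U F : PowerSeries R} (hU0 : ‖PowerSeries.constantCoeff U‖ = 1)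
    (hU : ∀ i, ‖PowerSeries.coeff i U‖ ≤ 1) (hF : HasMaxCoeff F) :
    ‖PowerSeries.coeff (normLam F) (U * F)‖ = ‖PowerSeries.coeff (normLam F) F‖ := by
  set l := normLam F with hl
  -- split the antidiagonal sum into the term `(0, l)` and the rest
  rw [PowerSeries.coeff_mul, ← Finset.add_sum_erase _ _
    (Finset.HasAntidiagonal.mem_antidiagonal.mpr (zero_add l) :
      ((0 : ℕ), l) ∈ Finset.HasAntidiagonal.antidiagonal l)]
  have hlead : ‖PowerSeries.coeff 0 U * PowerSeries.coeff l F‖ = ‖PowerSeries.coeff l F‖ := by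
    rw [norm_mul, PowerSeries.coeff_zero_eq_constantCoeff, hU0, one_mul]
  by_cases h0 : ‖PowerSeries.coeff l F‖ = 0
  · -- everything is `≤ 0`
    refine le_antisymm ?_ ?_
    · calc _ ≤ max ‖PowerSeries.coeff 0 U * PowerSeries.coeff l F‖
            ‖∑ ij ∈ (Finset.HasAntidiagonal.antidiagonal l).erase (0, l),
              PowerSeries.coeff ij.1 U * PowerSeries.coeff ij.2 F‖ := IsUltrametricDist.norm_add_le_max _ _
        _ ≤ ‖PowerSeries.coeff l F‖ := by
          refine max_le hlead.le ?_
          refine IsUltrametricDist.norm_sum_le_of_forall_le_of_nonneg (norm_nonneg _) fun ij hij => ?_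
          rw [norm_mul]
          calc ‖PowerSeries.coeff ij.1 U‖ * ‖PowerSeries.coeff ij.2 F‖
              ≤ 1 * ‖PowerSeries.coeff ij.2 F‖ := mul_le_mul_of_nonneg_right (hU _) (norm_nonneg _)
            _ ≤ ‖PowerSeries.coeff l F‖ := by
                rw [one_mul]; exact isMaxCoeffAt_normLam hF _
    · rw [h0]; exact norm_nonneg _
  · have hpos : 0 < ‖PowerSeries.coeff l F‖ := lt_of_le_of_ne (norm_nonneg _) (Ne.symm h0)
    have hrest : ‖∑ ij ∈ (Finset.HasAntidiagonal.antidiagonal l).erase (0, l),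
        PowerSeries.coeff ij.1 U * PowerSeries.coeff ij.2 F‖ < ‖PowerSeries.coeff l F‖ := by
      refine norm_sum_lt_of_forall_lt hpos fun ij hij => ?_
      have hne : ij ≠ (0, l) := Finset.ne_of_mem_erase hij
      have hij' := Finset.HasAntidiagonal.mem_antidiagonal.mp (Finset.mem_of_mem_erase hij)
      have hj : ij.2 < l := by
        rcases Nat.lt_or_ge ij.2 l with h | h
        · exact h
        · exfalso; apply hne
          have h2 : ij.2 = l := by omega
          have h1 : ij.1 = 0 := by omega
          exact Prod.ext h1 h2
      rw [norm_mul]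
      calc ‖PowerSeries.coeff ij.1 U‖ * ‖PowerSeries.coeff ij.2 F‖
          ≤ 1 * ‖PowerSeries.coeff ij.2 F‖ := mul_le_mul_of_nonneg_right (hU _) (norm_nonneg _)
        _ < ‖PowerSeries.coeff l F‖ := by rw [one_mul]; exact norm_coeff_lt_of_lt_normLam hj
    rw [← hlead] at hrest ⊢
    exact IsUltrametricDist.norm_add_eq_max_of_norm_ne_norm (ne_of_gt hrest) ▸ max_eq_left hrest.le

/-- **`U·F` attains its maximal coefficient norm, at `normLam F`**, for `U` with unit constant term
and integral coefficients. [folklore] -/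
theorem isMaxCoeffAt_mul_of_integral_unit {U F : PowerSeries R}
    (hU0 : ‖PowerSeries.constantCoeff U‖ = 1) (hU : ∀ i, ‖PowerSeries.coeff i U‖ ≤ 1)
    (hF : HasMaxCoeff F) : IsMaxCoeffAt (U * F) (normLam F) := fun m => by
  rw [norm_coeff_mul_normLam_eq hU0 hU hF]
  exact norm_coeff_mul_le_of_integral hU (norm_nonneg _) fun j _ => isMaxCoeffAt_normLam hF j

/-- `HasMaxCoeff (U·F)`. [folklore] -/
theorem hasMaxCoeff_mul_of_integral_unit {U F : PowerSeries R}
    (hU0 : ‖PowerSeries.constantCoeff U‖ = 1) (hU : ∀ i, ‖PowerSeries.coeff i U‖ ≤ 1)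
    (hF : HasMaxCoeff F) : HasMaxCoeff (U * F) :=
  ⟨normLam F, isMaxCoeffAt_mul_of_integral_unit hU0 hU hF⟩

/-- **`normLam (U·F) = normLam F`** for `U` with unit constant term and integral coefficients and
`F` attaining its maximum with a non-zero coefficient — a unit of `Λ_𝒪` does not change `λ`
(Washington §7.1; EPW Def. 4.4.6). [cite: Washington1997, §7.1] -/
theorem normLam_mul_of_integral_unit {U F : PowerSeries R}
    (hU0 : ‖PowerSeries.constantCoeff U‖ = 1) (hU : ∀ i, ‖PowerSeries.coeff i U‖ ≤ 1)
    (hF : HasMaxCoeff F) (h0 : ∃ n, ‖PowerSeries.coeff n F‖ ≠ 0) :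
    normLam (U * F) = normLam F := by
  rw [normLam_eq_iff (hasMaxCoeff_mul_of_integral_unit hU0 hU hF)]
  refine ⟨isMaxCoeffAt_mul_of_integral_unit hU0 hU hF, fun m hm => ?_⟩
  rw [norm_coeff_mul_normLam_eq hU0 hU hF]
  exact norm_coeff_mul_lt_of_integral hU (norm_coeff_normLam_pos hF h0)
    fun j hj => norm_coeff_lt_of_lt_normLam (lt_of_le_of_lt hj hm)

end Ultrametric

end Summit.BirchSwinnertonDyer.Rank1Residual.X11a.LambdaNorm

end
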